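import Literature.MathematicalPhysics.QuantumFieldTheory.Balaban1983to89.B9Cor36GDirKnitRowsAtMemberY

/-!
# `Balaban1983to89.B9CubeDirInverseBondCRowsNamedY` — [Balaban1985BackgroundPropagators] Cor. 3.6 p. 408 for the Dirichlet bond letter of record: THE UNIFORM
# CONSTANTS `(δ, B, M₀, T₀, N₀, d_B, a₁)` OF dag-n06-c's ✓`cubeRowsGDirCY_at_memberU` NAMED (closed terms, à la ✓`gpd36*`), so that the member-wide heads
# «KE₂₁X-C» ∕ «KESC-CO» can DISPLAY its four rows and their x-free numerics by name — seat dag-n06-d g35 (row `pub-ymgap-dag-n06-d` s2, «knit N06 at ₁₁»)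

statement-level skeleton of published theorems with citation tags; proofs where landed; nothing here is a claim about the Yang–Mills mass gap

CITATION HEADER (lean-in-tree rule).  B9 = T. Bałaban, *Propagators for lattice gauge theories in a background field*, Commun. Math. Phys. **99** (1985)
389–434 [Balaban1985BackgroundPropagators] (held `paper:balaban1985-cmp99-background-propagators`; journal page = PDF page + 388): Cor. 3.6 p. 408 l. 1–14
(«all the results of these theorems are gauge invariant … the constants depend on d and L only»), Cor. 3.5 p. 407, Thm 3.3 p. 399, Thm 3.1 (3.42) p. 397, (3.35)
p. 396, p. 409 l. 1–5.  [4] = [Balaban1984PropagatorsII] Lemma 2.1 (2.61) p. 234, (2.51) p. 232, Prop. 2.6 (2.136) p. 247, p. 248 l. 4–5.  Rows B9.Cor3.6 × B9.Thm3.3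
(cells only; no row head changes).

WHY THIS FILE (cell `pub-ymgap`, node N06 [B9]; LOCATED-37).  The member-wide knit certificate «KE₂₀X-C» (✓`…N06AtOpsYSectEStKnitRecordKE20XC`) displays the
supplier's bond deliverable `hRowsA : ∀ x …, ∀ □, CubeRowsGDirCY x.toKIdx □ U dB B δ α` at ∀-bound constants `(dB, B, δ, α)` together with the x-free numerics
`(c_b Σ‖b‖)²·(B·c₁ dB δ α) ≤ B_c`, `δ₀ ≤ (1 − α)δ`.  dag-n06-c g34's chain F1–F6 (✓`cubeRowsGDirCY_at_member`) inhabits the bundle from four displayed rows (the bond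
datum `DatumBUY`, the bond socket on `mDirC`, the flat right half of (3.42)₃, [4] Prop. 2.6 by name) with ∃-packaged constants; its α₀-UNIFORM edition
✓`cubeRowsGDirCY_at_memberU` (v1.1, this seat) chooses them BEFORE the member's auxiliary `α₀`, so they depend only on `(N, d, ℓ, b₀, b₁, M*, α₀′, ϱ′, ϱ)` and on
PROPOSITIONS (the named fact, `1 ≤ ℓ`, `0 < b₀ ≤ b₁`, the knit-engine numerics).  THIS FILE closes the propositions off by `dite` and NAMES the constants
`gdirδ ∕ gdirB ∕ gdirM₀ ∕ gdirT₀ ∕ gdirN₀ ∕ gdirdB ∕ gdira₁` (closed terms: outside the hypothesis pack they default to `1 ∕ 0 ∕ 0 ∕ 0 ∕ 0 ∕ 0 ∕ 1`, so the sign facts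
`0 < gdirδ`, `0 ≤ gdirB`, `0 < gdira₁` hold unconditionally), and restates the uniform theorem AT THE NAMES under the pack `GDirPackY` — the shape the heads consume.

WHAT IS PROVED (defs `GDirPackY`, `RowsBodyY` (bundling `Prop`s with bodies) and the seven named constants; theorems; 0 sorry; 0 new named facts; standard axioms):
* §1 `GDirPackY` (the hypothesis pack of ✓`cubeRowsGDirCY_at_memberU`), `RowsBodyY` (its universal block at given constants), `rowsBodyY_of_pack` (the uniform
  theorem, re-keyed);
* §2 the names and ★★`gdir_rows_of_pack : GDirPackY … → RowsBodyY … (gdirδ …) (gdirB …) (gdirM₀ …) (gdirT₀ …) (gdirN₀ …) (gdirdB …) (gdira₁ …)`, the sign facts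
  `gdirδ_pos`, `gdirB_nonneg`, `gdira₁_pos` (unconditional), ★`cubeRowsGDirCY_named` (the bundle at one `(x, U, □)`-family, heads' binder order).

HONEST SCOPE / NOT CLAIMED.  Naming + bookkeeping over landed modules; no estimate is proved here; everything stays CONDITIONAL BY NAME on [4] Prop. 2.6 for `G(Ω)`
(inside `GDirPackY`) and displays the bond datum (LOCATED-32), the bond socket ([4] (2.21)–(2.22), not in the tree for the Dirichlet letter) and the flat right
half of (3.42)₃ (cell GAPS G-B9-02).  Nothing on `d = 4`, the continuum, reflection positivity or the mass gap; NOT a node discharge; count-neutral; no row head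
changes.  NEW file; nothing landed is modified.  `--supports stmt-QuantumFields-27239`.

RELATED IN THE TREE, NOT DUPLICATED (searched 2026-08-31: `rg 'gdirδ|gdirB|gdira₁|GDirPackY|RowsBodyY'` over `Literature/` + `Summits/` = ∅): ✓`B9Cor36GDirKnitRowsAtMemberY`
(the theorem named here, USED), ✓`B9Cor36GpDirMemberBlocksAtRecordY` §2 (the site-letter twin `gpd36*` — the pattern), ✓`B9CubeDirInverseBondCMemberRowsAtRecordY`
(the bundle `CubeRowsGDirCY` and its consumer interface `h36Ab_at_member_of_cubeRows`).
-/

noncomputable section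

namespace Literature.MathematicalPhysics.QuantumFieldTheory.Balaban1983to89.B9CubeDirInverseBondCRowsNamedY

open B6RandomWalk (HasMajorant)
open B9Thm34Ext (toB6)
open B9Eq352DivFormLetters (conj)
open B6KLevelCensusIndexV1 (KIdx kGeo)
open B6Cover236MultiLevelBlocks (cubes)
open B6GlobalChartV1 (PV)
open B9Eq360DeltaPrimeAY (AfldY)
open B9Eq337CutFieldDirY (cutCfgS)
open B9CubeGeometryInputs (geoCK RM1)
open B9Cor35GCubeInputsAtOne (blkBK)
open B9Cor35GpDirInputsAtOne (dirDomY)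
open B9Cor35GDirInputsAtOne (GiK mDirC geoDirBI domDirBI admDirBI GDirBFam)
open B9Cor35GDirKnitInputsAtOne (TKnitCY)
open B9Cor36GDirKnitRowsAtMemberY (DatumBWit DatumBUY cubeRowsGDirCY_at_memberU)
open B9CubeDirInverseBondCMemberRowsAtRecordY (CubeRowsGDirCY)
open B9PinMembersKLevelV1 (MemberY)
open B9CoReadingCoordsTranspose (trBasis)
open B9CoReadingCoords (cdsBₗ)
open B9C2FormBoxRegimeY (Kpl)
open B7Prop5CplxLevels (epsCplx tauCplx)
open B7Prop2Explicit (unitaryUnits C0 c2')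
open B7Prop3Flat (c3)
open Node00 (SiteY FBondY CfgY GaugeY toKT)
open Node00.OpsYCubeDirInverseBond (bondsOverY)
open scoped Matrix Matrix.Norms.L2Operator

/-! ## §1  The hypothesis pack and the universal block of the uniform theorem -/

section Pack

/-- **THE HYPOTHESIS PACK OF ✓`cubeRowsGDirCY_at_memberU`**: [4] Prop. 2.6 for the Dirichlet bond family BY NAME (`B6.Prop26DirichletPrinted … GDirBFam`, NOT proved),
the index facts `1 ≤ ℓ`, `0 < b₀ ≤ b₁`, and dag-n06-j's x-free knit-engine numerics at `(α₀′, ϱ′, ϱ)` — the propositions the named constants close over.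
[cite: Balaban1984PropagatorsII, Prop. 2.6 (2.136) p.247, p.248 l.4–5; Balaban1985BackgroundPropagators, Cor. 3.6 p.408, (3.83) p.407] -/
def GDirPackY (d ℓ : ℕ) (hd : 1 ≤ d + 1) (hL : Odd (ℓ + 1) ∧ 1 < ℓ + 1) (b₀ b₁ : ℝ) (α₀' ϱ' ϱ : ℝ) : Prop :=
  B6.Prop26DirichletPrinted (geoDirBI (d := d) (ℓ := ℓ) (hd := hd) (hL := hL) (b₀ := b₀) (b₁ := b₁)) domDirBI admDirBI GDirBFam ∧
  1 ≤ ℓ ∧ 0 < b₀ ∧ b₀ ≤ b₁ ∧ 0 < α₀' ∧ C0 (d + 1) * α₀' ≤ 1 / 3 ∧ 8 * α₀' ≤ c2' (d + 1) (ℓ + 1) ∧ 0 < ϱ' ∧ 0 < ϱ ∧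
  Real.exp (4 * (800 * (((d + 1 : ℕ) : ℝ) + 1) ^ 2 * (((d + 1 : ℕ) : ℝ) + 4)) * α₀') * (1 + 8 * (131072 * (((d + 1 : ℕ) : ℝ) + 1) ^ 2) * ϱ') ≤ 2 ∧
  2 * ϱ' ≤ c3 (d + 1) (ℓ + 1) ∧ 409600 * (((d + 1 : ℕ) : ℝ) + 1) ^ 2 * ϱ' ≤ 1 ∧ epsCplx (d + 1) (ℓ + 1) ϱ' 0 ≤ 1 / 16 ∧
  ((d + 1 : ℕ) : ℝ) * (epsCplx (d + 1) (ℓ + 1) ϱ' 0 + tauCplx (d + 1) (ℓ + 1) α₀' 0 ϱ' 0) ≤ 1 / 16 ∧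
  Real.exp (4480 * (((d + 1 : ℕ) : ℝ) + 1) ^ 2 * (((d + 1 : ℕ) : ℝ) + 4) * α₀' + 240000 * (((d + 1 : ℕ) : ℝ) + 1) ^ 3 * ϱ') *
      (1 + 8 * (2097152 * (((d + 1 : ℕ) : ℝ) + 1) ^ 2) * ϱ) ≤ 2 ∧
  2 * ϱ ≤ c3 (d + 1) (ℓ + 1) / 4

/-- **THE UNIVERSAL BLOCK OF ✓`cubeRowsGDirCY_at_memberU` AT GIVEN CONSTANTS `(δ, B, M₀, T₀, N₀, d_B, a₁)`**: for every member above the thresholds, every auxiliary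
`α₀ > 0` with `K_pl(Mα₀)L⁴ < α₀′`, every unitary-valued `U` with a bond socket at every cube, every `B₂ ≥ 0`, the bond datum at `a₁` and the flat right half
of (3.42)₃ at `B₂`: the bundle `CubeRowsGDirCY x.toKIdx □ U d_B (B₂ + B) δ (9∕5000)` at every `□`.
[cite: Balaban1985BackgroundPropagators, Cor. 3.6 p.408 l.1–14, Thm 3.1 (3.42) p.397, (3.35) p.396; Balaban1984PropagatorsII, Lemma 2.1 (2.61) p.234] -/
def RowsBodyY (N : ℕ) [Nonempty (Fin N)] (d ℓ : ℕ) (hd : 1 ≤ d + 1) (hL : Odd (ℓ + 1) ∧ 1 < ℓ + 1) (b₀ b₁ : ℝ) (Mstar : ℕ) (α₀' ϱ' : ℝ)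
    (δ B M₀ T₀ : ℝ) (N₀ dB : ℕ) (a₁ : ℝ) : Prop :=
  ∀ (x : MemberY d ℓ hd hL b₀ b₁ Mstar),
    M₀ ≤ ((ℓ : ℝ) + 1) * (toKT x.toKIdx).Mh → N₀ + 1 ≤ (toKT x.toKIdx).R * ((ℓ + 1) * (toKT x.toKIdx).Mh) → T₀ ≤ RM1 x.toKIdx →
  ∀ α₀ : ℝ, 0 < α₀ → 0 ≤ (kGeo x.toKIdx).M * α₀ → Kpl x.toKIdx ((kGeo x.toKIdx).M * α₀) * (kGeo x.toKIdx).L ^ 4 < α₀' →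
  ∀ (U : CfgY (Matrix (Fin N) (Fin N) ℂ) x.toKIdx), (∀ μ z, U μ z ∈ unitaryUnits (Matrix (Fin N) (Fin N) ℂ)) →
    (∀ c' : ↥(cubes x.toKIdx.D.toDomains), ∃ KB : Matrix (FBondY x.toKIdx) (FBondY x.toKIdx) ℝ,
      (mDirC x.toKIdx c').submatrix (fun v : ↥(bondsOverY x.toKIdx (dirDomY x.toKIdx c')) => (v : FBondY x.toKIdx))
          (fun v : ↥(bondsOverY x.toKIdx (dirDomY x.toKIdx c')) => (v : FBondY x.toKIdx)) *
        KB.submatrix (fun v : ↥(bondsOverY x.toKIdx (dirDomY x.toKIdx c')) => (v : FBondY x.toKIdx))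
          (fun v : ↥(bondsOverY x.toKIdx (dirDomY x.toKIdx c')) => (v : FBondY x.toKIdx)) = 1) →
  ∀ (B₂ : ℝ), 0 ≤ B₂ →
    (∀ c' : ↥(cubes x.toKIdx.D.toDomains), DatumBUY x.toKIdx c' U a₁ α₀' ϱ') →
    (∀ (c' : ↥(cubes x.toKIdx.D.toDomains)) (u : GaugeY (Matrix (Fin N) (Fin N) ℂ) x.toKIdx) (A : AfldY (Matrix (Fin N) (Fin N) ℂ) x.toKIdx)
        (Q : Set (Site (PV d ℓ x.toKIdx.m x.toKIdx.K hd hL) 0)) (T : Finset (SiteY x.toKIdx)) (C ξ Λ : ℝ),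
        DatumBWit x.toKIdx c' U a₁ α₀' ϱ' u A Q T C ξ Λ → ∀ (Rr : ℝ) (Hc : Prop) (ν : Fin (d + 1)),
          HasMajorant (g := toB6 (geoCK x.toKIdx c') Rr Hc) (blkBK x.toKIdx c')
            (GiK (trBasis N) x.toKIdx (TKnitCY x.toKIdx c' (cutCfgS x.toKIdx T (kGeo x.toKIdx).eta A)) (bondsOverY x.toKIdx (dirDomY x.toKIdx c')) *
              conj (trBasis N) (cdsBₗ x.toKIdx (fun _ _ => (1 : (Matrix (Fin N) (Fin N) ℂ)ˣ)) ν))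
            (fun a a' => B₂ * (geoCK x.toKIdx c').len a * Real.exp (-(δ * (geoCK x.toKIdx c').dist a a')))) →
    ∀ c' : ↥(cubes x.toKIdx.D.toDomains), CubeRowsGDirCY x.toKIdx c' U dB (B₂ + B) δ (9 / 5000)

/-- ✓`cubeRowsGDirCY_at_memberU` RE-KEYED ON THE PACK: under `GDirPackY` there are constants with `RowsBodyY`.
[cite: Balaban1985BackgroundPropagators, Cor. 3.6 p.408 l.1–14; Balaban1984PropagatorsII, Prop. 2.6 (2.136) p.247] -/
theorem rowsBodyY_of_pack (N : ℕ) [Nonempty (Fin N)] (d ℓ : ℕ) (hd : 1 ≤ d + 1) (hL : Odd (ℓ + 1) ∧ 1 < ℓ + 1) (b₀ b₁ : ℝ) (Mstar : ℕ) (α₀' ϱ' ϱ : ℝ)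
    (h : GDirPackY d ℓ hd hL b₀ b₁ α₀' ϱ' ϱ) :
    ∃ δ B M₀ T₀ : ℝ, ∃ N₀ dB : ℕ, 0 < δ ∧ 0 ≤ B ∧ ∃ a₁ : ℝ, 0 < a₁ ∧ RowsBodyY N d ℓ hd hL b₀ b₁ Mstar α₀' ϱ' δ B M₀ T₀ N₀ dB a₁ := by
  obtain ⟨h26, hℓ, hb₀, hb₁, hα', hα3, hα8, hϱ', hϱ, hsmall', hc₃', hϱ'1, hE, hdX, hsmallJ, hc₃J⟩ := h
  exact cubeRowsGDirCY_at_memberU (N := N) (Mstar := Mstar) h26 hℓ hb₀ hb₁ hα' hα3 hα8 hϱ' hϱ hsmall' hc₃' hϱ'1 hE hdX hsmallJ hc₃J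

end Pack

/-! ## §2  The names, the rows at the names, the sign facts -/

section Names

open Classical in
/-- **the uniform decay rate `δ` of the bundle, NAMED** (default `1` outside the pack). [cite: Balaban1985BackgroundPropagators, Thm 3.3 p.399, Cor. 3.6 p.408] -/
def gdirδ (N : ℕ) [Nonempty (Fin N)] (d ℓ : ℕ) (hd : 1 ≤ d + 1) (hL : Odd (ℓ + 1) ∧ 1 < ℓ + 1) (b₀ b₁ : ℝ) (Mstar : ℕ) (α₀' ϱ' ϱ : ℝ) : ℝ :=
  if h : GDirPackY d ℓ hd hL b₀ b₁ α₀' ϱ' ϱ then (rowsBodyY_of_pack N d ℓ hd hL b₀ b₁ Mstar α₀' ϱ' ϱ h).choose else 1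

open Classical in
/-- **the uniform entry constant `B` of the bundle, NAMED** (default `0`). [cite: Balaban1985BackgroundPropagators, Thm 3.1 (3.42) p.397, Cor. 3.6 p.408] -/
def gdirB (N : ℕ) [Nonempty (Fin N)] (d ℓ : ℕ) (hd : 1 ≤ d + 1) (hL : Odd (ℓ + 1) ∧ 1 < ℓ + 1) (b₀ b₁ : ℝ) (Mstar : ℕ) (α₀' ϱ' ϱ : ℝ) : ℝ :=
  if h : GDirPackY d ℓ hd hL b₀ b₁ α₀' ϱ' ϱ then (rowsBodyY_of_pack N d ℓ hd hL b₀ b₁ Mstar α₀' ϱ' ϱ h).choose_spec.choose else 0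

open Classical in
/-- **the member threshold `M₀` (`M₀ ≤ L·M_h`), NAMED** (default `0`). [cite: Balaban1985BackgroundPropagators, Thm 3.3 p.399 («M sufficiently large»)] -/
def gdirM₀ (N : ℕ) [Nonempty (Fin N)] (d ℓ : ℕ) (hd : 1 ≤ d + 1) (hL : Odd (ℓ + 1) ∧ 1 < ℓ + 1) (b₀ b₁ : ℝ) (Mstar : ℕ) (α₀' ϱ' ϱ : ℝ) : ℝ :=
  if h : GDirPackY d ℓ hd hL b₀ b₁ α₀' ϱ' ϱ then (rowsBodyY_of_pack N d ℓ hd hL b₀ b₁ Mstar α₀' ϱ' ϱ h).choose_spec.choose_spec.choose else 0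

open Classical in
/-- **the level-run threshold `T₀` (`T₀ ≤ R_{M,1}`), NAMED** (default `0`). [cite: Balaban1984PropagatorsII, (2.2) p.224; Balaban1985BackgroundPropagators, Cor. 3.6 p.408] -/
def gdirT₀ (N : ℕ) [Nonempty (Fin N)] (d ℓ : ℕ) (hd : 1 ≤ d + 1) (hL : Odd (ℓ + 1) ∧ 1 < ℓ + 1) (b₀ b₁ : ℝ) (Mstar : ℕ) (α₀' ϱ' ϱ : ℝ) : ℝ :=
  if h : GDirPackY d ℓ hd hL b₀ b₁ α₀' ϱ' ϱ then (rowsBodyY_of_pack N d ℓ hd hL b₀ b₁ Mstar α₀' ϱ' ϱ h).choose_spec.choose_spec.choose_spec.choose else 0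

open Classical in
/-- **the band threshold `N₀` (`N₀ + 1 ≤ R·L·M_h`), NAMED** (default `0`). [cite: Balaban1984PropagatorsII, (2.2) p.224, Lemma 2.1 (2.61) p.234] -/
def gdirN₀ (N : ℕ) [Nonempty (Fin N)] (d ℓ : ℕ) (hd : 1 ≤ d + 1) (hL : Odd (ℓ + 1) ∧ 1 < ℓ + 1) (b₀ b₁ : ℝ) (Mstar : ℕ) (α₀' ϱ' ϱ : ℝ) : ℕ :=
  if h : GDirPackY d ℓ hd hL b₀ b₁ α₀' ϱ' ϱ then (rowsBodyY_of_pack N d ℓ hd hL b₀ b₁ Mstar α₀' ϱ' ϱ h).choose_spec.choose_spec.choose_spec.choose_spec.choose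
  else 0

open Classical in
/-- **the (2.61) splitting exponent `d_B`, NAMED** (default `0`). [cite: Balaban1984PropagatorsII, Lemma 2.1 (2.61) p.234] -/
def gdirdB (N : ℕ) [Nonempty (Fin N)] (d ℓ : ℕ) (hd : 1 ≤ d + 1) (hL : Odd (ℓ + 1) ∧ 1 < ℓ + 1) (b₀ b₁ : ℝ) (Mstar : ℕ) (α₀' ϱ' ϱ : ℝ) : ℕ :=
  if h : GDirPackY d ℓ hd hL b₀ b₁ α₀' ϱ' ϱ then
    (rowsBodyY_of_pack N d ℓ hd hL b₀ b₁ Mstar α₀' ϱ' ϱ h).choose_spec.choose_spec.choose_spec.choose_spec.choose_spec.choose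
  else 0

open Classical in
/-- **the smallness threshold `a₁` of the bond datum (`2CΛ² ≤ a₁`), NAMED** (default `1`). [cite: Balaban1985BackgroundPropagators, (3.35) p.396, Cor. 3.6 p.408] -/
def gdira₁ (N : ℕ) [Nonempty (Fin N)] (d ℓ : ℕ) (hd : 1 ≤ d + 1) (hL : Odd (ℓ + 1) ∧ 1 < ℓ + 1) (b₀ b₁ : ℝ) (Mstar : ℕ) (α₀' ϱ' ϱ : ℝ) : ℝ :=
  if h : GDirPackY d ℓ hd hL b₀ b₁ α₀' ϱ' ϱ then
    (rowsBodyY_of_pack N d ℓ hd hL b₀ b₁ Mstar α₀' ϱ' ϱ h).choose_spec.choose_spec.choose_spec.choose_spec.choose_spec.choose_spec.2.2.choose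
  else 1

/-- ★★ **THE UNIFORM THEOREM AT THE NAMES**: under the pack, `0 < gdirδ`, `0 ≤ gdirB`, `0 < gdira₁` and the universal block `RowsBodyY` at the seven named constants.
[cite: Balaban1985BackgroundPropagators, Cor. 3.6 p.408 l.1–14, Thm 3.3 p.399, Thm 3.1 (3.42) p.397; Balaban1984PropagatorsII, Prop. 2.6 (2.136) p.247, Lemma 2.1 (2.61) p.234] -/
theorem gdir_rows_of_pack (N : ℕ) [Nonempty (Fin N)] (d ℓ : ℕ) (hd : 1 ≤ d + 1) (hL : Odd (ℓ + 1) ∧ 1 < ℓ + 1) (b₀ b₁ : ℝ) (Mstar : ℕ) (α₀' ϱ' ϱ : ℝ)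
    (h : GDirPackY d ℓ hd hL b₀ b₁ α₀' ϱ' ϱ) :
    0 < gdirδ N d ℓ hd hL b₀ b₁ Mstar α₀' ϱ' ϱ ∧ 0 ≤ gdirB N d ℓ hd hL b₀ b₁ Mstar α₀' ϱ' ϱ ∧ 0 < gdira₁ N d ℓ hd hL b₀ b₁ Mstar α₀' ϱ' ϱ ∧
      RowsBodyY N d ℓ hd hL b₀ b₁ Mstar α₀' ϱ' (gdirδ N d ℓ hd hL b₀ b₁ Mstar α₀' ϱ' ϱ) (gdirB N d ℓ hd hL b₀ b₁ Mstar α₀' ϱ' ϱ)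
        (gdirM₀ N d ℓ hd hL b₀ b₁ Mstar α₀' ϱ' ϱ) (gdirT₀ N d ℓ hd hL b₀ b₁ Mstar α₀' ϱ' ϱ) (gdirN₀ N d ℓ hd hL b₀ b₁ Mstar α₀' ϱ' ϱ)
        (gdirdB N d ℓ hd hL b₀ b₁ Mstar α₀' ϱ' ϱ) (gdira₁ N d ℓ hd hL b₀ b₁ Mstar α₀' ϱ' ϱ) := by
  have H := (rowsBodyY_of_pack N d ℓ hd hL b₀ b₁ Mstar α₀' ϱ' ϱ h).choose_spec.choose_spec.choose_spec.choose_spec.choose_spec.choose_spec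
  simp only [gdirδ, gdirB, gdirM₀, gdirT₀, gdirN₀, gdirdB, gdira₁, dif_pos h]
  exact ⟨H.1, H.2.1, H.2.2.choose_spec.1, H.2.2.choose_spec.2⟩

/-- `0 < gdirδ` unconditionally. [cite: Balaban1985BackgroundPropagators, Thm 3.3 p.399, bookkeeping] -/
theorem gdirδ_pos (N : ℕ) [Nonempty (Fin N)] (d ℓ : ℕ) (hd : 1 ≤ d + 1) (hL : Odd (ℓ + 1) ∧ 1 < ℓ + 1) (b₀ b₁ : ℝ) (Mstar : ℕ) (α₀' ϱ' ϱ : ℝ) :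
    0 < gdirδ N d ℓ hd hL b₀ b₁ Mstar α₀' ϱ' ϱ := by
  by_cases h : GDirPackY d ℓ hd hL b₀ b₁ α₀' ϱ' ϱ
  · exact (gdir_rows_of_pack N d ℓ hd hL b₀ b₁ Mstar α₀' ϱ' ϱ h).1
  · rw [gdirδ, dif_neg h]; exact one_pos

/-- `0 ≤ gdirB` unconditionally. [cite: Balaban1985BackgroundPropagators, Thm 3.1 (3.42) p.397, bookkeeping] -/
theorem gdirB_nonneg (N : ℕ) [Nonempty (Fin N)] (d ℓ : ℕ) (hd : 1 ≤ d + 1) (hL : Odd (ℓ + 1) ∧ 1 < ℓ + 1) (b₀ b₁ : ℝ) (Mstar : ℕ) (α₀' ϱ' ϱ : ℝ) :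
    0 ≤ gdirB N d ℓ hd hL b₀ b₁ Mstar α₀' ϱ' ϱ := by
  by_cases h : GDirPackY d ℓ hd hL b₀ b₁ α₀' ϱ' ϱ
  · exact (gdir_rows_of_pack N d ℓ hd hL b₀ b₁ Mstar α₀' ϱ' ϱ h).2.1
  · rw [gdirB, dif_neg h]

/-- `0 < gdira₁` unconditionally. [cite: Balaban1985BackgroundPropagators, (3.35) p.396, bookkeeping] -/
theorem gdira₁_pos (N : ℕ) [Nonempty (Fin N)] (d ℓ : ℕ) (hd : 1 ≤ d + 1) (hL : Odd (ℓ + 1) ∧ 1 < ℓ + 1) (b₀ b₁ : ℝ) (Mstar : ℕ) (α₀' ϱ' ϱ : ℝ) :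
    0 < gdira₁ N d ℓ hd hL b₀ b₁ Mstar α₀' ϱ' ϱ := by
  by_cases h : GDirPackY d ℓ hd hL b₀ b₁ α₀' ϱ' ϱ
  · exact (gdir_rows_of_pack N d ℓ hd hL b₀ b₁ Mstar α₀' ϱ' ϱ h).2.2.1
  · rw [gdira₁, dif_neg h]; exact one_pos

/-- ★ **THE BUNDLE AT ONE MEMBER, ONE AUXILIARY `α₀`, ONE UNITARY-VALUED `U`, EVERY CUBE — HEADS' BINDER ORDER**: the four displayed rows (socket, bond datum at
`gdira₁`, flat right half at `B₂` and rate `gdirδ`, the pack) and the three named thresholds give `CubeRowsGDirCY x.toKIdx □ U gdirdB (B₂ + gdirB) gdirδ (9∕5000)`.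
[cite: Balaban1985BackgroundPropagators, Cor. 3.6 p.408 l.1–14, Thm 3.1 (3.42) p.397, (3.35) p.396, p.409 l.1–5] -/
theorem cubeRowsGDirCY_named {N : ℕ} [Nonempty (Fin N)] {d ℓ : ℕ} {hd : 1 ≤ d + 1} {hL : Odd (ℓ + 1) ∧ 1 < ℓ + 1} {b₀ b₁ : ℝ} {Mstar : ℕ} {α₀' ϱ' ϱ : ℝ}
    (h : GDirPackY d ℓ hd hL b₀ b₁ α₀' ϱ' ϱ) (x : MemberY d ℓ hd hL b₀ b₁ Mstar)
    (hM : gdirM₀ N d ℓ hd hL b₀ b₁ Mstar α₀' ϱ' ϱ ≤ ((ℓ : ℝ) + 1) * (toKT x.toKIdx).Mh)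
    (hN : gdirN₀ N d ℓ hd hL b₀ b₁ Mstar α₀' ϱ' ϱ + 1 ≤ (toKT x.toKIdx).R * ((ℓ + 1) * (toKT x.toKIdx).Mh))
    (hT : gdirT₀ N d ℓ hd hL b₀ b₁ Mstar α₀' ϱ' ϱ ≤ RM1 x.toKIdx)
    {α₀ : ℝ} (hα₀ : 0 < α₀) (hMα : 0 ≤ (kGeo x.toKIdx).M * α₀) (hKpl : Kpl x.toKIdx ((kGeo x.toKIdx).M * α₀) * (kGeo x.toKIdx).L ^ 4 < α₀')
    (U : CfgY (Matrix (Fin N) (Fin N) ℂ) x.toKIdx) (hUu : ∀ μ z, U μ z ∈ unitaryUnits (Matrix (Fin N) (Fin N) ℂ))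
    (hKB : ∀ c' : ↥(cubes x.toKIdx.D.toDomains), ∃ KB : Matrix (FBondY x.toKIdx) (FBondY x.toKIdx) ℝ,
      (mDirC x.toKIdx c').submatrix (fun v : ↥(bondsOverY x.toKIdx (dirDomY x.toKIdx c')) => (v : FBondY x.toKIdx))
          (fun v : ↥(bondsOverY x.toKIdx (dirDomY x.toKIdx c')) => (v : FBondY x.toKIdx)) *
        KB.submatrix (fun v : ↥(bondsOverY x.toKIdx (dirDomY x.toKIdx c')) => (v : FBondY x.toKIdx))
          (fun v : ↥(bondsOverY x.toKIdx (dirDomY x.toKIdx c')) => (v : FBondY x.toKIdx)) = 1)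
    {B₂ : ℝ} (hB₂ : 0 ≤ B₂)
    (hDat : ∀ c' : ↥(cubes x.toKIdx.D.toDomains), DatumBUY x.toKIdx c' U (gdira₁ N d ℓ hd hL b₀ b₁ Mstar α₀' ϱ' ϱ) α₀' ϱ')
    (hR : ∀ (c' : ↥(cubes x.toKIdx.D.toDomains)) (u : GaugeY (Matrix (Fin N) (Fin N) ℂ) x.toKIdx) (A : AfldY (Matrix (Fin N) (Fin N) ℂ) x.toKIdx)
        (Q : Set (Site (PV d ℓ x.toKIdx.m x.toKIdx.K hd hL) 0)) (T : Finset (SiteY x.toKIdx)) (C ξ Λ : ℝ),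
        DatumBWit x.toKIdx c' U (gdira₁ N d ℓ hd hL b₀ b₁ Mstar α₀' ϱ' ϱ) α₀' ϱ' u A Q T C ξ Λ → ∀ (Rr : ℝ) (Hc : Prop) (ν : Fin (d + 1)),
          HasMajorant (g := toB6 (geoCK x.toKIdx c') Rr Hc) (blkBK x.toKIdx c')
            (GiK (trBasis N) x.toKIdx (TKnitCY x.toKIdx c' (cutCfgS x.toKIdx T (kGeo x.toKIdx).eta A)) (bondsOverY x.toKIdx (dirDomY x.toKIdx c')) *
              conj (trBasis N) (cdsBₗ x.toKIdx (fun _ _ => (1 : (Matrix (Fin N) (Fin N) ℂ)ˣ)) ν))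
            (fun a a' => B₂ * (geoCK x.toKIdx c').len a * Real.exp (-(gdirδ N d ℓ hd hL b₀ b₁ Mstar α₀' ϱ' ϱ * (geoCK x.toKIdx c').dist a a'))))
    (c' : ↥(cubes x.toKIdx.D.toDomains)) :
    CubeRowsGDirCY x.toKIdx c' U (gdirdB N d ℓ hd hL b₀ b₁ Mstar α₀' ϱ' ϱ) (B₂ + gdirB N d ℓ hd hL b₀ b₁ Mstar α₀' ϱ' ϱ)
      (gdirδ N d ℓ hd hL b₀ b₁ Mstar α₀' ϱ' ϱ) (9 / 5000) :=
  (gdir_rows_of_pack N d ℓ hd hL b₀ b₁ Mstar α₀' ϱ' ϱ h).2.2.2 x hM hN hT α₀ hα₀ hMα hKpl U hUu hKB B₂ hB₂ hDat hR c'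

end Names

end Literature.MathematicalPhysics.QuantumFieldTheory.Balaban1983to89.B9CubeDirInverseBondCRowsNamedY

end
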